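import Mathlib
import Summits.NavierStokesRegularity.NavierStokesRegularity.Theorems.EulerZoomLiouvillePowerGaugeEulerLiouvilleSelfSimilarTimeOneLinearisation
import Summits.NavierStokesRegularity.NavierStokesRegularity.Theorems.EulerZoomLiouvillePowerGaugeEulerLiouvilleSelfSimilarExpSplitting
import HarnessLib

/-!
# Rung C1 of the crux `EulerZoomLiouville.PowerGaugeEulerLiouville`: GENERIC HYPERBOLIC NON-SOURCES ARE THIN, and the
# crux idea «hyperbolic-stagnation exclusion» for generic hyperbolic stagnation sets
# (route №10, item stmt-NavierStokesRegularity-19832; `--supports`)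

Helper file (theorems only). Seat ns-typeII-p3 (cell ns-regularity-ideate §B, D-0081).  Third sequel to
`…SelfSimilarFiniteHyperbolic`, composing `…SelfSimilarTimeOneLinearisation` (`D(Φ_1)(z) = exp DW(z)`),
`…SelfSimilarExpSplitting` (Lyapunov pairs ⇒ hyperbolic splitting of `exp A`) and `…SelfSimilarSourceSpiral`
(`exists_adapted_of_blockBasis`, `sum_blockDiag_eq_three_mul`, `curl_eq_zero_near_blockSource`):

* `mapsTo_span_singleton_of_blockBasis`, `mapsTo_span_pair_of_blockBasis`, `isCompl_span_singleton_span_pair`,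
  `span_pair_ne_top`, `span_singleton_ne_top` — the eigenline `span{b₂}` and the block plane `span{b₀,b₁}` of a real
  block normal form `A b₀ = d₀b₀ − βb₁`, `A b₁ = βb₀ + d₁b₁`, `A b₂ = d₂b₂` are complementary proper `A`-invariant
  subspaces;
* `exists_adapted_on_span_pair` — a Lyapunov pair on the block plane pinching `A` in `[min(d₀,d₁), max(d₀,d₁)]`
  (the rotation `β` cancels; via `exists_adapted_of_blockBasis` applied to the operator agreeing with `A` on the plane);
* **`isHyperbolicSplitting_exp_of_blockBasis_neg` / `…_pos`** — GENERIC SADDLES ARE THIN: `d₀, d₁ > 0 > d₂` (resp.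
  `d₀, d₁ < 0 < d₂`) ⇒ `exp A` hyperbolic with `Eu = span{b₀,b₁}` (resp. `span{b₂}`) `≠ ⊤`;
* **`eq_zero_of_finite_genericHyperbolicStagnation`** — THE IDEA CARD'S THEOREM FOR GENERIC HYPERBOLIC STAGNATION
  SETS: a classical in-window profile (`0 < γ < ½`, `V` smooth bounded, `‖DV‖ ≤ K`, `P` bounded above, far field
  `DV → 0`, `V(0) = 0`) whose stagnation set is finite, with `DW(z) = γI + DV(z)` at every node in real block normal
  form with `d₀, d₁` of ONE STRICT SIGN and `d₂ ≠ 0` (every node whose linearisation has three distinct eigenvalues,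
  none on the imaginary axis, has such a basis: real eigenvalues `β = 0`; complex pair `d₀ = d₁ = Re λ`, `β = Im λ`),
  is trivial — conditional only on the cited fact `Robinson1999_stableManifoldTheorem`.  (All `dᵢ > 0`: generic
  source, fat by `curl_eq_zero_near_blockSource` — this is where the window `Σdᵢ = 3γ < 1 + γ` enters;
  `d₀, d₁ > 0 > d₂`: thin; `d₀, d₁ < 0`: then `d₂ = 3γ − d₀ − d₁ > 0` by the trace identity, thin.)

Refuter reading (rung C1, classical members): a refuting in-window profile with the far field needs INFINITELY MANY
stagnation points, or a stagnation point of `γy + V` whose linearisation has an eigenvalue ON THE IMAGINARY AXIS or a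
REPEATED eigenvalue admitting no block basis of the above form.

WHAT THIS IS NOT: not NS, not E, not rung C1 — the generic-hyperbolic classical sub-case of the C1 residue, modulo the
Robinson fact.  [folklore; cf. ConstantinIgnatovaVicol2026Putative §3.5 Thms 3.8/3.10; HaleMagalhaesOliva2002
Def. 7.2.1; Robinson1999 Ch. V Thm 10.1]
-/

noncomputable section

-- flat `Theorems/<Route><Decl>…` files of one crux share the namespace of the crux (tree convention)
set_option linter.dupNamespace false

open MeasureTheory Set Filter Topology Metric Function InnerProductSpace
open scoped RealInnerProductSpace NNReal ContDiff Nat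

namespace Summit.NavierStokesRegularity.NavierStokesRegularity.Theorems.PowerGaugeEulerLiouville.Kelvin

open Literature.Analysis Literature.Analysis.FluidPDE Literature.Dynamics.FixedPoints

variable {γ : ℝ} {V : EuclideanSpace ℝ (Fin 3) → EuclideanSpace ℝ (Fin 3)} {P : EuclideanSpace ℝ (Fin 3) → ℝ}

/-! ### Generic hyperbolic non-sources (real block normal form with signed rates) are thin -/

/-- The eigenline `span{b₂}` is `A`-invariant. [folklore] -/
theorem mapsTo_span_singleton_of_blockBasis (A : EuclideanSpace ℝ (Fin 3) →L[ℝ] EuclideanSpace ℝ (Fin 3))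
    (b : Module.Basis (Fin 3) ℝ (EuclideanSpace ℝ (Fin 3))) (lam : Fin 3 → ℝ) (hA2 : A (b 2) = lam 2 • b 2) :
    ∀ x ∈ Submodule.span ℝ ({b 2} : Set (EuclideanSpace ℝ (Fin 3))), A x ∈ Submodule.span ℝ {b 2} := by
  intro x hx
  obtain ⟨a, rfl⟩ := Submodule.mem_span_singleton.1 hx
  rw [map_smul, hA2, smul_smul]
  exact Submodule.mem_span_singleton.2 ⟨a * lam 2, rfl⟩

/-- The block plane `span{b₀, b₁}` is `A`-invariant. [folklore] -/
theorem mapsTo_span_pair_of_blockBasis (A : EuclideanSpace ℝ (Fin 3) →L[ℝ] EuclideanSpace ℝ (Fin 3))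
    (b : Module.Basis (Fin 3) ℝ (EuclideanSpace ℝ (Fin 3))) (lam : Fin 3 → ℝ) (β : ℝ)
    (hA0 : A (b 0) = lam 0 • b 0 - β • b 1) (hA1 : A (b 1) = β • b 0 + lam 1 • b 1) :
    ∀ x ∈ Submodule.span ℝ ({b 0, b 1} : Set (EuclideanSpace ℝ (Fin 3))),
      A x ∈ Submodule.span ℝ {b 0, b 1} := by
  intro x hx
  obtain ⟨c, d, rfl⟩ := Submodule.mem_span_pair.1 hx
  rw [map_add, map_smul, map_smul, hA0, hA1]
  refine Submodule.mem_span_pair.2 ⟨c * lam 0 + d * β, -(c * β) + d * lam 1, ?_⟩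
  module

/-- On the eigenline, `⟪A h, h⟫ = λ₂‖h‖²` (Euclidean Lyapunov pair with `G = id`). [folklore] -/
theorem inner_apply_self_of_mem_span_singleton (A : EuclideanSpace ℝ (Fin 3) →L[ℝ] EuclideanSpace ℝ (Fin 3))
    (b : Module.Basis (Fin 3) ℝ (EuclideanSpace ℝ (Fin 3))) (lam : Fin 3 → ℝ) (hA2 : A (b 2) = lam 2 • b 2)
    {h : EuclideanSpace ℝ (Fin 3)} (hh : h ∈ Submodule.span ℝ ({b 2} : Set (EuclideanSpace ℝ (Fin 3)))) :
    ⟪A h, h⟫ = lam 2 * ‖h‖ ^ 2 := by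
  obtain ⟨a, rfl⟩ := Submodule.mem_span_singleton.1 hh
  rw [map_smul, hA2, smul_smul, real_inner_smul_left, real_inner_smul_right, norm_smul, mul_pow,
    Real.norm_eq_abs, sq_abs, real_inner_self_eq_norm_sq]
  ring

/-- **A Lyapunov pair for the block plane**: if `A b₀ = d₀b₀ − βb₁`, `A b₁ = βb₀ + d₁b₁` then there is a symmetric
coercive `G` with `μ₀⟪Gh,h⟫ ≤ ⟪G(Ah),h⟫ ≤ Λ₀⟪Gh,h⟫` for all `h ∈ span{b₀,b₁}`, whenever `μ₀ ≤ d₀, d₁ ≤ Λ₀` (apply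
`exists_adapted_of_blockBasis` to the operator that agrees with `A` on the plane and acts as `d₀` on `b₂`; the
rotation `β` cancels). [folklore] -/
theorem exists_adapted_on_span_pair (A : EuclideanSpace ℝ (Fin 3) →L[ℝ] EuclideanSpace ℝ (Fin 3))
    (b : Module.Basis (Fin 3) ℝ (EuclideanSpace ℝ (Fin 3))) (lam : Fin 3 → ℝ) (β : ℝ)
    (hA0 : A (b 0) = lam 0 • b 0 - β • b 1) (hA1 : A (b 1) = β • b 0 + lam 1 • b 1)
    {μ₀ Λ₀ : ℝ} (h0lo : μ₀ ≤ lam 0) (h1lo : μ₀ ≤ lam 1) (h0hi : lam 0 ≤ Λ₀) (h1hi : lam 1 ≤ Λ₀) :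
    ∃ G : EuclideanSpace ℝ (Fin 3) →L[ℝ] EuclideanSpace ℝ (Fin 3),
      (∀ u v : EuclideanSpace ℝ (Fin 3), ⟪G u, v⟫ = ⟪u, G v⟫) ∧
      (∃ g₀ : ℝ, 0 < g₀ ∧ ∀ h : EuclideanSpace ℝ (Fin 3), g₀ * ‖h‖ ^ 2 ≤ ⟪G h, h⟫) ∧
      (∀ h ∈ Submodule.span ℝ ({b 0, b 1} : Set (EuclideanSpace ℝ (Fin 3))),
        μ₀ * ⟪G h, h⟫ ≤ ⟪G (A h), h⟫ ∧ ⟪G (A h), h⟫ ≤ Λ₀ * ⟪G h, h⟫) := by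
  -- the auxiliary operator `A'`: `A` on the plane, `d₀` on `b₂`
  let A' : EuclideanSpace ℝ (Fin 3) →L[ℝ] EuclideanSpace ℝ (Fin 3) :=
    LinearMap.toContinuousLinearMap (b.constr ℝ ![lam 0 • b 0 - β • b 1, β • b 0 + lam 1 • b 1, lam 0 • b 2])
  have hA'0 : A' (b 0) = lam 0 • b 0 - β • b 1 := by
    show (b.constr ℝ _) (b 0) = _; rw [Module.Basis.constr_basis]; rfl
  have hA'1 : A' (b 1) = β • b 0 + lam 1 • b 1 := by
    show (b.constr ℝ _) (b 1) = _; rw [Module.Basis.constr_basis]; rfl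
  have hA'2 : A' (b 2) = lam 0 • b 2 := by
    show (b.constr ℝ _) (b 2) = _; rw [Module.Basis.constr_basis]; rfl
  obtain ⟨G, hGsym, hGpos, hGA⟩ := exists_adapted_of_blockBasis A' b ![lam 0, lam 1, lam 0] β
    (by simpa using hA'0) (by simpa using hA'1) (by simpa using hA'2) (μ₀ := μ₀) (Λ₀ := Λ₀)
    (fun i => by fin_cases i <;> simpa) (fun i => by fin_cases i <;> simpa)
  refine ⟨G, hGsym, hGpos, fun h hh => ?_⟩
  -- on the plane `A' = A`
  have hAA' : A h = A' h := by
    obtain ⟨c, d, rfl⟩ := Submodule.mem_span_pair.1 hh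
    rw [map_add, map_smul, map_smul, hA0, hA1, map_add, map_smul, map_smul, hA'0, hA'1]
  rw [hAA']
  exact hGA h

/-- `span{b₂}` and `span{b₀, b₁}` are complementary. [folklore] -/
theorem isCompl_span_singleton_span_pair (b : Module.Basis (Fin 3) ℝ (EuclideanSpace ℝ (Fin 3))) :
    IsCompl (Submodule.span ℝ ({b 2} : Set (EuclideanSpace ℝ (Fin 3)))) (Submodule.span ℝ {b 0, b 1}) := by
  have h := b.linearIndependent.isCompl_span_image b.span_eq (s := {2}) (t := {0, 1}) ?_
  · simpa [Set.image_singleton, Set.image_pair] using h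
  · rw [isCompl_iff, disjoint_iff, codisjoint_iff]
    constructor
    · ext i
      fin_cases i <;> simp
    · ext i
      fin_cases i <;> simp

/-- `span{b₀, b₁} ≠ ⊤` (it misses `b₂`). [folklore] -/
theorem span_pair_ne_top (b : Module.Basis (Fin 3) ℝ (EuclideanSpace ℝ (Fin 3))) :
    Submodule.span ℝ ({b 0, b 1} : Set (EuclideanSpace ℝ (Fin 3))) ≠ ⊤ := by
  intro htop
  have h := b.linearIndependent.notMem_span_image (s := {0, 1}) (x := 2) (by simp)
  rw [Set.image_pair, htop] at h
  exact h Submodule.mem_top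

/-- `span{b₂} ≠ ⊤` (it misses `b₀`). [folklore] -/
theorem span_singleton_ne_top (b : Module.Basis (Fin 3) ℝ (EuclideanSpace ℝ (Fin 3))) :
    Submodule.span ℝ ({b 2} : Set (EuclideanSpace ℝ (Fin 3))) ≠ ⊤ := by
  intro htop
  have h := b.linearIndependent.notMem_span_image (s := {2}) (x := 0) (by simp)
  rw [Set.image_singleton, htop] at h
  exact h Submodule.mem_top

/-- **Generic SADDLE with expanding plane is thin**: `A b₀ = d₀b₀ − βb₁`, `A b₁ = βb₀ + d₁b₁`, `A b₂ = d₂b₂` with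
`d₀, d₁ > 0 > d₂` ⇒ `exp A` is hyperbolic with `Es = span{b₂}`, `Eu = span{b₀,b₁} ≠ ⊤`.
[cite: HaleMagalhaesOliva2002, §6.1 and Def. 7.2.1] -/
theorem isHyperbolicSplitting_exp_of_blockBasis_neg (A : EuclideanSpace ℝ (Fin 3) →L[ℝ] EuclideanSpace ℝ (Fin 3))
    (b : Module.Basis (Fin 3) ℝ (EuclideanSpace ℝ (Fin 3))) (lam : Fin 3 → ℝ) (β : ℝ)
    (hA0 : A (b 0) = lam 0 • b 0 - β • b 1) (hA1 : A (b 1) = β • b 0 + lam 1 • b 1)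
    (hA2 : A (b 2) = lam 2 • b 2) (h0 : 0 < lam 0) (h1 : 0 < lam 1) (h2 : lam 2 < 0) :
    IsHyperbolicSplitting (NormedSpace.exp A) (Submodule.span ℝ {b 2}) (Submodule.span ℝ {b 0, b 1}) ∧
      Submodule.span ℝ ({b 0, b 1} : Set (EuclideanSpace ℝ (Fin 3))) ≠ ⊤ := by
  obtain ⟨Gu, hGu_sym, ⟨gu, hgu, hGu_pos⟩, hGuA⟩ := exists_adapted_on_span_pair A b lam β hA0 hA1
    (μ₀ := min (lam 0) (lam 1)) (Λ₀ := max (lam 0) (lam 1))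
    (min_le_left _ _) (min_le_right _ _) (le_max_left _ _) (le_max_right _ _)
  refine ⟨isHyperbolicSplitting_exp A (ContinuousLinearMap.id ℝ _) Gu (isCompl_span_singleton_span_pair b)
    (mapsTo_span_singleton_of_blockBasis A b lam hA2) (mapsTo_span_pair_of_blockBasis A b lam β hA0 hA1)
    (fun u v => by simp) (gs := 1) one_pos
    (fun h => by rw [ContinuousLinearMap.id_apply, real_inner_self_eq_norm_sq, one_mul]) (μs := -lam 2)
    (by linarith) (fun h hh => ?_) hGu_sym hgu hGu_pos (μu := min (lam 0) (lam 1)) (lt_min h0 h1)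
    (fun h hh => (hGuA h hh).1), span_pair_ne_top b⟩
  rw [ContinuousLinearMap.id_apply, ContinuousLinearMap.id_apply, inner_apply_self_of_mem_span_singleton A b lam hA2 hh,
    real_inner_self_eq_norm_sq]
  ring_nf
  rfl

/-- **Generic SADDLE with expanding line is thin**: `A b₀ = d₀b₀ − βb₁`, `A b₁ = βb₀ + d₁b₁`, `A b₂ = d₂b₂` with
`d₀, d₁ < 0 < d₂` ⇒ `exp A` is hyperbolic with `Es = span{b₀,b₁}`, `Eu = span{b₂} ≠ ⊤`.
[cite: HaleMagalhaesOliva2002, §6.1 and Def. 7.2.1] -/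
theorem isHyperbolicSplitting_exp_of_blockBasis_pos (A : EuclideanSpace ℝ (Fin 3) →L[ℝ] EuclideanSpace ℝ (Fin 3))
    (b : Module.Basis (Fin 3) ℝ (EuclideanSpace ℝ (Fin 3))) (lam : Fin 3 → ℝ) (β : ℝ)
    (hA0 : A (b 0) = lam 0 • b 0 - β • b 1) (hA1 : A (b 1) = β • b 0 + lam 1 • b 1)
    (hA2 : A (b 2) = lam 2 • b 2) (h0 : lam 0 < 0) (h1 : lam 1 < 0) (h2 : 0 < lam 2) :
    IsHyperbolicSplitting (NormedSpace.exp A) (Submodule.span ℝ {b 0, b 1}) (Submodule.span ℝ {b 2}) ∧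
      Submodule.span ℝ ({b 2} : Set (EuclideanSpace ℝ (Fin 3))) ≠ ⊤ := by
  obtain ⟨Gs, hGs_sym, ⟨gs, hgs, hGs_pos⟩, hGsA⟩ := exists_adapted_on_span_pair A b lam β hA0 hA1
    (μ₀ := min (lam 0) (lam 1)) (Λ₀ := max (lam 0) (lam 1))
    (min_le_left _ _) (min_le_right _ _) (le_max_left _ _) (le_max_right _ _)
  refine ⟨isHyperbolicSplitting_exp A Gs (ContinuousLinearMap.id ℝ _) (isCompl_span_singleton_span_pair b).symm
    (mapsTo_span_pair_of_blockBasis A b lam β hA0 hA1) (mapsTo_span_singleton_of_blockBasis A b lam hA2)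
    hGs_sym hgs hGs_pos (μs := -max (lam 0) (lam 1)) (by have := max_lt h0 h1; linarith)
    (fun h hh => by have := (hGsA h hh).2; linarith)
    (fun u v => by simp) (gu := 1) one_pos
    (fun h => by rw [ContinuousLinearMap.id_apply, real_inner_self_eq_norm_sq, one_mul]) (μu := lam 2) h2
    (fun h hh => ?_), span_singleton_ne_top b⟩
  rw [ContinuousLinearMap.id_apply, ContinuousLinearMap.id_apply, inner_apply_self_of_mem_span_singleton A b lam hA2 hh,
    real_inner_self_eq_norm_sq]

/-! ### The idea card's theorem for generic hyperbolic stagnation sets -/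

/-- **HYPERBOLIC-STAGNATION EXCLUSION, GENERIC FORM.**  Let `(V, P)` be a classical self-similar Euler profile in the
window `0 < γ < ½` (`V` smooth and bounded, `‖DV‖ ≤ K`, `P` bounded above, far field `DV → 0`, `V(0) = 0`) whose
similarity field `W = γy + V` has FINITELY MANY stagnation points, at each of which `DW(z) = γI + DV(z)` has a real
block normal form `A b₀ = d₀b₀ − βb₁`, `A b₁ = βb₀ + d₁b₁`, `A b₂ = d₂b₂` with `d₀, d₁` of ONE STRICT SIGN and
`d₂ ≠ 0` (this holds at every stagnation point whose linearisation has three distinct eigenvalues, none on the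
imaginary axis: real eigenvalues `β = 0`, complex pair `d₀ = d₁ = Re λ`, `β = Im λ`).  Then `V ≡ 0`.  Conditional
on the named fact `Robinson1999_stableManifoldTheorem`.  (Sources `dᵢ > 0` are fat by `curl_eq_zero_near_blockSource`
— the trace identity `Σdᵢ = 3γ < 1 + γ` is where the window enters; the other nodes are thin saddles by
`isHyperbolicSplitting_exp_of_blockBasis_neg/_pos` and `fderiv_flow_eq_exp_smul`; `d₀, d₁ < 0` forces `d₂ > 0` by the
trace identity.) [cite: ConstantinIgnatovaVicol2026Putative, §3.5 Thms 3.8/3.10 (strengthened); Robinson1999, Ch. V Thm 10.1] -/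
theorem eq_zero_of_finite_genericHyperbolicStagnation (hSMT : Robinson1999_stableManifoldTheorem.{0})
    (hV : ContDiff ℝ ∞ V) {K : ℝ} (hK : ∀ y, ‖fderiv ℝ V y‖ ≤ K)
    (hprof : IsSelfSimilarEulerProfile γ 0 V P) {M P₀ : ℝ} (hM : ∀ y, ‖V y‖ ≤ M) (hP : ∀ y, P y ≤ P₀)
    (hγ : 0 < γ) (hγ2 : γ < 1 / 2) (hfin : (selfSimilarNodalSet γ 0 V).Finite)
    (hnodes : ∀ z ∈ selfSimilarNodalSet γ 0 V,
      ∃ (b : Module.Basis (Fin 3) ℝ (EuclideanSpace ℝ (Fin 3))) (lam : Fin 3 → ℝ) (β : ℝ),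
        (γ • ContinuousLinearMap.id ℝ (EuclideanSpace ℝ (Fin 3)) + fderiv ℝ V z) (b 0) = lam 0 • b 0 - β • b 1 ∧
        (γ • ContinuousLinearMap.id ℝ (EuclideanSpace ℝ (Fin 3)) + fderiv ℝ V z) (b 1) = β • b 0 + lam 1 • b 1 ∧
        (γ • ContinuousLinearMap.id ℝ (EuclideanSpace ℝ (Fin 3)) + fderiv ℝ V z) (b 2) = lam 2 • b 2 ∧
        ((0 < lam 0 ∧ 0 < lam 1) ∨ (lam 0 < 0 ∧ lam 1 < 0)) ∧ lam 2 ≠ 0)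
    (hfar : Tendsto (fun y => ‖fderiv ℝ V y‖) (cocompact (EuclideanSpace ℝ (Fin 3))) (𝓝 0)) (h0 : V 0 = 0) :
    V = 0 := by
  refine eq_zero_of_finiteHyperbolicStagnation hSMT hV hK hprof hM hP hγ hγ2 hfin (fun z hz => ?_) hfar h0
  obtain ⟨b, lam, β, hA0, hA1, hA2, hsign, h2ne⟩ := hnodes z hz
  have htr := sum_blockDiag_eq_three_mul (γ := γ) hprof.divFree z b lam β hA0 hA1 hA2
  have hexp := fderiv_flow_one_eq_exp hV hK hz
  rcases hsign with ⟨h0p, h1p⟩ | ⟨h0n, h1n⟩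
  · rcases lt_or_gt_of_ne h2ne with h2n | h2p
    · -- saddle with expanding plane
      obtain ⟨hsplit, hne⟩ := isHyperbolicSplitting_exp_of_blockBasis_neg _ b lam β hA0 hA1 hA2 h0p h1p h2n
      refine Or.inr ⟨Submodule.span ℝ {b 2}, Submodule.span ℝ {b 0, b 1}, ?_, hne⟩
      rw [hexp]
      exact hsplit
    · -- generic source
      exact Or.inl ⟨b, lam, β, hA0, hA1, hA2, fun i => by fin_cases i <;> assumption⟩
  · -- `d₀, d₁ < 0` ⇒ `d₂ = 3γ − d₀ − d₁ > 0`: saddle with expanding line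
    have h2p : 0 < lam 2 := by linarith
    obtain ⟨hsplit, hne⟩ := isHyperbolicSplitting_exp_of_blockBasis_pos _ b lam β hA0 hA1 hA2 h0n h1n h2p
    refine Or.inr ⟨Submodule.span ℝ {b 0, b 1}, Submodule.span ℝ {b 2}, ?_, hne⟩
    rw [hexp]
    exact hsplit


end Summit.NavierStokesRegularity.NavierStokesRegularity.Theorems.PowerGaugeEulerLiouville.Kelvin

end
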